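import Mathlib.Analysis.Real.Sqrt
import Mathlib.Analysis.Complex.Basic
import Mathlib.LinearAlgebra.Matrix.ConjTranspose
import Mathlib.LinearAlgebra.Matrix.NonsingularInverse
import Mathlib.LinearAlgebra.Matrix.Notation
import Mathlib.Tactic.LinearCombination
import Mathlib.Tactic.FinCases
import HarnessLib

/-!
# The principal congruence subgroups `Γ(N)` of the unitary group of the Eisenstein lattice `𝓔^{1,4}`

Family `hodge`, layer `Literature/AlgebraicGeometry/ShimuraVarieties`. Companion of the definition
request `defn-HodgeModel.IsBallCoveredOff` (route `EisensteinMiddleThird` of the Hodge summit):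
the items `EisensteinTowerHodge`, `TowerMiddleAlgebraic`, `LevelThreeMiddleAlgebraic`,
`LevelThreeCanonicalForms` spell INLINE, inside `Matrix (Fin 5) (Fin 5) ℂ`, the unitary group of the
self-dual Eisenstein lattice and its principal congruence subgroups; this file names them.

**Setting** (Allcock–Freitag §2; Allcock–Carlson–Toledo). `𝓔 = ℤ[ω]`, `ω = (−1 + i√3)/2` a
primitive cube root of unity, is the ring of Eisenstein integers; `Λ = 𝓔^{1,4}` is `𝓔⁵` with the
hermitian form of signature `(1,4)`
`⟨a, b⟩ = ā₀b₀ − ā₁b₁ − ā₂b₂ − ā₃b₃ − ā₄b₄` (Allcock–Freitag (2.1)), Gram matrix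
`J = diag(1, −1, −1, −1, −1)`; "`Aut(Λ)` is the unitary group of this lattice, i.e. the group of
`𝓔`-module automorphisms which preserve the hermitian form" — as complex matrices: the `γ` with
entries in `𝓔` and `γᴴ J γ = J` (such a `γ` is invertible with inverse `J γᴴ J`, again of this form,
`inv_mem_eisensteinUnitary`). `Aut(Λ) \ 𝓑⁴` is the moduli space of cubic surfaces
(Allcock–Carlson–Toledo); Allcock–Freitag's `Γ` is the congruence subgroup of level `√−3` (kernel
of `Aut(Λ) → O(5, 𝔽₃)`), and the route's census lives on the PRINCIPAL CONGRUENCE SUBGROUPS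
`Γ(N) = {γ ∈ Aut(Λ) | γ ≡ 1 mod N}`, `N ∈ ℕ` (level `3 = (√−3)²` first).

Contents (everything stated VERBATIM as in the items — `ω` spelled
`(-1 + Complex.I * (Real.sqrt 3 : ℂ)) / 2`, `J` spelled `Matrix.diagonal ![(1 : ℂ), -1, -1, -1, -1]`
— with named abbreviations proved equal by `rfl`):
* `eisensteinOmega = ω` with `ω² = −1 − ω`, `ω³ = 1`, `conj ω = −1 − ω = ω²`;
* `IsEisensteinInteger x` (`x ∈ 𝓔 ⊂ ℂ`: `∃ a b : ℤ, x = a + b ω`), a subring of `ℂ` stable under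
  complex conjugation (`zero`, `one`, `intCast`, `natCast`, `add`, `neg`, `sub`, `mul`, `sum`,
  `star`);
* `eisensteinGram = J`, `J * J = 1`, `Jᴴ = J`;
* `eisensteinUnitary = Aut(Λ)` (the items' conjunct "`∀ γ ∈ S`, entries in `𝓔` and `γᴴJγ = J`")
  and `eisensteinUnitaryLevel N = Γ(N)` (the items' conjunct
  "`∀ γ, (∀ i j, ∃ a b : ℤ, γ i j − 1 i j = N (a + b ω)) → γᴴJγ = J → γ ∈ S`"), with:
  unfolding lemmas (`Iff.rfl`); the matrix form `γ = 1 + N • X`, `X` integral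
  (`mem_eisensteinUnitaryLevel_iff_exists`); `Γ(1) = Aut(Λ)`, `Γ(0) = {1}`, `Γ(N) ⊆ Aut(Λ)`,
  `M ∣ N → Γ(N) ⊆ Γ(M)`; GROUP STRUCTURE under matrix multiplication — `1 ∈ Γ(N)`, closure under
  products, every element is invertible with `γ⁻¹ = J γᴴ J ∈ Γ(N)` — and NORMALITY of `Γ(N)` in
  `Aut(Λ)` (`conj_mem_eisensteinUnitaryLevel`).

## Design notes

* Typed inside `Matrix (Fin 5) (Fin 5) ℂ` (not `GL₅` of the number field `ℚ(√−3)`), because that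
  is how the route's items consume it: the deck-relation set `S : Set (Matrix (Fin 5) (Fin 5) ℂ)`
  of `HodgeModel.IsBallCoveredOff` (file `HodgeTheory/BallQuotientCompactification`). The abstract
  version for a CM field `E` and a Gram matrix over `E` is `principalCongruenceSubgroup` of
  `UnitaryBallQuotientDatum` (same directory); the bridge along `ℚ(√−3) ⊂ ℂ` is not needed by the
  items and is NOT here.
* `Γ(0) = {1}` (`eisensteinUnitaryLevel_zero`) — the items require `0 < N`.
* NOT here (wanted later by the route, real theorems): `Γ(3)` is torsion-free (Minkowski–Serre:
  the kernel of reduction modulo `𝔭ᵏ` is torsion-free once `k > e(𝔭|p)/(p−1)`; here `p = 3`,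
  `𝔭 = (√−3)`, `e = 2`, so level `(3) = 𝔭²` works while level `√−3` contains the triflections) and
  neat; finite index of `Γ(N)` in `Aut(Λ)`; `Aut(Λ)/Γ(√−3) ≅ O(5,3) ≅ W(E₆) × {±1}`
  (Allcock–Freitag §2).

## References

* D. Allcock, E. Freitag, *Cubic surfaces and Borcherds products*, Comment. Math. Helv. 77
  (2002), §2 ((2.1), the lattice `Λ = 𝓔^{1,4}`, `Aut(Λ)`, the level-`√−3` subgroup `Γ`).
* D. Allcock, J. Carlson, D. Toledo, *The complex hyperbolic geometry of the moduli space of cubic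
  surfaces*, J. Algebraic Geom. 11 (2002).
-/

noncomputable section

open scoped Matrix ComplexConjugate

namespace Literature.AlgebraicGeometry.ShimuraVarieties

/-! ### The Eisenstein integers inside `ℂ` -/

/-- The primitive cube root of unity `ω = (−1 + i√3)/2 ∈ ℂ`, spelled as in the items of route
`EisensteinMiddleThird`. [cite: AllcockFreitag2002, §2] -/
def eisensteinOmega : ℂ := (-1 + Complex.I * (Real.sqrt 3 : ℂ)) / 2

/-- `(√3)² = 3` in `ℂ`. [folklore] -/
theorem sqrt_three_mul_self : (Real.sqrt 3 : ℂ) * (Real.sqrt 3 : ℂ) = 3 := by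
  rw [← Complex.ofReal_mul, Real.mul_self_sqrt (by norm_num : (0 : ℝ) ≤ 3)]
  norm_num

/-- `ω² = −1 − ω` (`ω² + ω + 1 = 0`). [cite: AllcockFreitag2002, §2] -/
theorem eisensteinOmega_mul_self : eisensteinOmega * eisensteinOmega = -1 - eisensteinOmega := by
  unfold eisensteinOmega
  linear_combination ((Real.sqrt 3 : ℂ) * (Real.sqrt 3 : ℂ) / 4) * Complex.I_mul_I +
    (-1 / 4 : ℂ) * sqrt_three_mul_self

/-- `ω³ = 1`. [cite: AllcockFreitag2002, §2] -/
theorem eisensteinOmega_pow_three : eisensteinOmega ^ 3 = 1 := by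
  have h := eisensteinOmega_mul_self
  linear_combination (eisensteinOmega - 1) * h

/-- `ω ≠ 1` (else `ω² = −1 − ω` would read `1 = −2`), so `ω` is a PRIMITIVE cube root of unity.
[cite: AllcockFreitag2002, §2] -/
theorem eisensteinOmega_ne_one : eisensteinOmega ≠ 1 := by
  intro h
  have h2 := eisensteinOmega_mul_self
  rw [h] at h2
  norm_num at h2

/-- Complex conjugation: `conj ω = −1 − ω` (`= ω²`). [cite: AllcockFreitag2002, §2] -/
theorem conj_eisensteinOmega : conj eisensteinOmega = -1 - eisensteinOmega := by
  unfold eisensteinOmega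
  rw [map_div₀, map_add, map_neg, map_one, map_mul, Complex.conj_I, Complex.conj_ofReal,
    map_ofNat]
  ring

/-- **`x` is an Eisenstein integer**: `x ∈ 𝓔 = ℤ[ω] = {a + b ω | a, b ∈ ℤ} ⊂ ℂ`, spelled as in the
items ("`∃ a b : ℤ, γ i j = (a : ℂ) + (b : ℂ) * ((-1 + Complex.I * (Real.sqrt 3 : ℂ)) / 2)`").
[cite: AllcockFreitag2002, §2] -/
def IsEisensteinInteger (x : ℂ) : Prop :=
  ∃ a b : ℤ, x = (a : ℂ) + (b : ℂ) * eisensteinOmega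

namespace IsEisensteinInteger

/-- Unfolding lemma, with `ω` spelled out as in the items. [cite: AllcockFreitag2002, §2] -/
theorem iff_literal (x : ℂ) :
    IsEisensteinInteger x ↔
      ∃ a b : ℤ, x = (a : ℂ) + (b : ℂ) * ((-1 + Complex.I * (Real.sqrt 3 : ℂ)) / 2) :=
  Iff.rfl

/-- Integers are Eisenstein integers. [folklore] -/
theorem intCast (a : ℤ) : IsEisensteinInteger (a : ℂ) :=
  ⟨a, 0, by push_cast; ring⟩

/-- Natural numbers are Eisenstein integers. [folklore] -/
theorem natCast (n : ℕ) : IsEisensteinInteger (n : ℂ) :=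
  ⟨n, 0, by push_cast; ring⟩

/-- `0 ∈ 𝓔`. [folklore] -/
theorem zero : IsEisensteinInteger 0 :=
  ⟨0, 0, by push_cast; ring⟩

/-- `1 ∈ 𝓔`. [folklore] -/
theorem one : IsEisensteinInteger 1 :=
  ⟨1, 0, by push_cast; ring⟩

/-- `ω ∈ 𝓔`. [folklore] -/
theorem omega : IsEisensteinInteger eisensteinOmega :=
  ⟨0, 1, by push_cast; ring⟩

/-- `𝓔` is closed under addition. [folklore] -/
theorem add {x y : ℂ} (hx : IsEisensteinInteger x) (hy : IsEisensteinInteger y) :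
    IsEisensteinInteger (x + y) := by
  obtain ⟨a, b, rfl⟩ := hx
  obtain ⟨c, d, rfl⟩ := hy
  exact ⟨a + c, b + d, by push_cast; ring⟩

/-- `𝓔` is closed under negation. [folklore] -/
theorem neg {x : ℂ} (hx : IsEisensteinInteger x) : IsEisensteinInteger (-x) := by
  obtain ⟨a, b, rfl⟩ := hx
  exact ⟨-a, -b, by push_cast; ring⟩

/-- `𝓔` is closed under subtraction. [folklore] -/
theorem sub {x y : ℂ} (hx : IsEisensteinInteger x) (hy : IsEisensteinInteger y) :
    IsEisensteinInteger (x - y) := by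
  simpa [sub_eq_add_neg] using hx.add hy.neg

/-- `𝓔` is closed under multiplication (`ω² = −1 − ω`):
`(a + bω)(c + dω) = (ac − bd) + (ad + bc − bd) ω`. [cite: AllcockFreitag2002, §2] -/
theorem mul {x y : ℂ} (hx : IsEisensteinInteger x) (hy : IsEisensteinInteger y) :
    IsEisensteinInteger (x * y) := by
  obtain ⟨a, b, rfl⟩ := hx
  obtain ⟨c, d, rfl⟩ := hy
  refine ⟨a * c - b * d, a * d + b * c - b * d, ?_⟩
  push_cast
  linear_combination ((b : ℂ) * d) * eisensteinOmega_mul_self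

/-- Finite sums of Eisenstein integers are Eisenstein integers. [folklore] -/
theorem sum {ι : Type*} (s : Finset ι) {f : ι → ℂ} (h : ∀ i ∈ s, IsEisensteinInteger (f i)) :
    IsEisensteinInteger (∑ i ∈ s, f i) :=
  Finset.sum_induction f IsEisensteinInteger (fun _ _ ha hb ↦ ha.add hb) zero h

/-- `𝓔` is stable under complex conjugation (`star = conj` on `ℂ`):
`conj (a + bω) = (a − b) − b ω`. [cite: AllcockFreitag2002, §2] -/
protected theorem star {x : ℂ} (hx : IsEisensteinInteger x) : IsEisensteinInteger (star x) := by
  obtain ⟨a, b, rfl⟩ := hx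
  refine ⟨a - b, -b, ?_⟩
  rw [Complex.star_def, map_add, map_mul, map_intCast, map_intCast, conj_eisensteinOmega]
  push_cast
  ring

end IsEisensteinInteger

/-! ### The Gram matrix `J = diag(1, −1, −1, −1, −1)` -/

/-- The Gram matrix `J = diag(1, −1, −1, −1, −1)` of the hermitian form
`⟨a, b⟩ = ā₀b₀ − ā₁b₁ − ⋯ − ā₄b₄` of signature `(1, 4)` on `Λ ⊗ ℂ = ℂ^{1,4}`, spelled as in the
items. [cite: AllcockFreitag2002, §2 (2.1)] -/
def eisensteinGram : Matrix (Fin 5) (Fin 5) ℂ := Matrix.diagonal ![(1 : ℂ), -1, -1, -1, -1]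

/-- The diagonal entries of `J` are `±1`, so square to `1`. [folklore] -/
theorem eisensteinGram_diag_mul_self (i : Fin 5) :
    (![(1 : ℂ), -1, -1, -1, -1] i) * (![(1 : ℂ), -1, -1, -1, -1] i) = 1 := by
  fin_cases i <;> simp

/-- The diagonal entries of `J` are integers, in particular Eisenstein integers. [folklore] -/
theorem isEisensteinInteger_eisensteinGram_diag (i : Fin 5) :
    IsEisensteinInteger (![(1 : ℂ), -1, -1, -1, -1] i) := by
  fin_cases i
  · exact IsEisensteinInteger.one
  all_goals exact IsEisensteinInteger.one.neg

/-- `J² = 1`. [folklore] -/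
theorem eisensteinGram_mul_self : eisensteinGram * eisensteinGram = 1 := by
  rw [eisensteinGram, Matrix.diagonal_mul_diagonal, ← Matrix.diagonal_one]
  congr 1
  funext i
  exact eisensteinGram_diag_mul_self i

/-- `Jᴴ = J` (real diagonal). [folklore] -/
theorem conjTranspose_eisensteinGram : eisensteinGramᴴ = eisensteinGram := by
  rw [eisensteinGram, Matrix.diagonal_conjTranspose]
  congr 1
  funext i
  fin_cases i <;> simp

/-! ### `Aut(Λ)` and its principal congruence subgroups, as complex matrices -/

/-- **`Aut(Λ)`, the unitary group of the Eisenstein lattice `Λ = 𝓔^{1,4}`, as complex `5 × 5`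
matrices**: entries in `𝓔 = ℤ[ω]` and `γᴴ J γ = J` — "the group of `𝓔`-module automorphisms
which preserve the hermitian form" (bijectivity is automatic: `γ⁻¹ = J γᴴ J`,
`inv_mem_eisensteinUnitary`). Spelled VERBATIM as the conjunct "`∀ γ ∈ S, …`" of the items of
route `EisensteinMiddleThird`. [cite: AllcockFreitag2002, §2] -/
def eisensteinUnitary : Set (Matrix (Fin 5) (Fin 5) ℂ) :=
  {γ | (∀ i j, ∃ a b : ℤ, γ i j = (a : ℂ) + (b : ℂ) * ((-1 + Complex.I * (Real.sqrt 3 : ℂ)) / 2)) ∧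
    γᴴ * Matrix.diagonal ![(1 : ℂ), -1, -1, -1, -1] * γ = Matrix.diagonal ![(1 : ℂ), -1, -1, -1, -1]}

/-- **The principal congruence subgroup `Γ(N) ⊆ Aut(Λ)` of level `N`**, as complex matrices:
`γ ≡ 1 (mod N)` entrywise in `𝓔` (`γᵢⱼ − δᵢⱼ ∈ N𝓔`) and `γᴴ J γ = J`. Spelled VERBATIM as the
conjunct "`∀ γ, (∀ i j, ∃ a b : ℤ, γ i j − 1 i j = N·(a + bω)) → γᴴJγ = J → γ ∈ S`" of the items of
route `EisensteinMiddleThird` (there `Γ(N) ⊆ S ⊆ Aut(Λ)`: `S` is a congruence subgroup); the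
level-`3` group `Γ(3)` is the `S` of `LevelThreeMiddleAlgebraic`. [cite: AllcockFreitag2002, §2] -/
def eisensteinUnitaryLevel (N : ℕ) : Set (Matrix (Fin 5) (Fin 5) ℂ) :=
  {γ | (∀ i j, ∃ a b : ℤ, γ i j - (1 : Matrix (Fin 5) (Fin 5) ℂ) i j =
        (N : ℂ) * ((a : ℂ) + (b : ℂ) * ((-1 + Complex.I * (Real.sqrt 3 : ℂ)) / 2))) ∧
    γᴴ * Matrix.diagonal ![(1 : ℂ), -1, -1, -1, -1] * γ = Matrix.diagonal ![(1 : ℂ), -1, -1, -1, -1]}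

/-- Unfolding lemma for `eisensteinUnitary` (verbatim the item text). [cite: AllcockFreitag2002, §2] -/
theorem mem_eisensteinUnitary_iff (γ : Matrix (Fin 5) (Fin 5) ℂ) :
    γ ∈ eisensteinUnitary ↔
      (∀ i j, ∃ a b : ℤ, γ i j = (a : ℂ) + (b : ℂ) * ((-1 + Complex.I * (Real.sqrt 3 : ℂ)) / 2)) ∧
        γᴴ * Matrix.diagonal ![(1 : ℂ), -1, -1, -1, -1] * γ =
          Matrix.diagonal ![(1 : ℂ), -1, -1, -1, -1] :=
  Iff.rfl

/-- `eisensteinUnitary` through the named pieces: integral entries and `γᴴ J γ = J`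
(definitionally the same). [cite: AllcockFreitag2002, §2] -/
theorem mem_eisensteinUnitary_iff' (γ : Matrix (Fin 5) (Fin 5) ℂ) :
    γ ∈ eisensteinUnitary ↔
      (∀ i j, IsEisensteinInteger (γ i j)) ∧ γᴴ * eisensteinGram * γ = eisensteinGram :=
  Iff.rfl

/-- Unfolding lemma for `eisensteinUnitaryLevel` (verbatim the item text).
[cite: AllcockFreitag2002, §2] -/
theorem mem_eisensteinUnitaryLevel_iff (N : ℕ) (γ : Matrix (Fin 5) (Fin 5) ℂ) :
    γ ∈ eisensteinUnitaryLevel N ↔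
      (∀ i j, ∃ a b : ℤ, γ i j - (1 : Matrix (Fin 5) (Fin 5) ℂ) i j =
          (N : ℂ) * ((a : ℂ) + (b : ℂ) * ((-1 + Complex.I * (Real.sqrt 3 : ℂ)) / 2))) ∧
        γᴴ * Matrix.diagonal ![(1 : ℂ), -1, -1, -1, -1] * γ =
          Matrix.diagonal ![(1 : ℂ), -1, -1, -1, -1] :=
  Iff.rfl

/-- **Matrix form of the congruence condition**: `γ ∈ Γ(N)` iff `γ = 1 + N • X` for a matrix `X`
with entries in `𝓔`, and `γᴴ J γ = J`. [cite: AllcockFreitag2002, §2] -/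
theorem mem_eisensteinUnitaryLevel_iff_exists (N : ℕ) (γ : Matrix (Fin 5) (Fin 5) ℂ) :
    γ ∈ eisensteinUnitaryLevel N ↔
      (∃ X : Matrix (Fin 5) (Fin 5) ℂ, (∀ i j, IsEisensteinInteger (X i j)) ∧
          γ = 1 + (N : ℂ) • X) ∧
        γᴴ * eisensteinGram * γ = eisensteinGram := by
  refine and_congr_left fun _ ↦ ⟨fun h ↦ ?_, ?_⟩
  · choose a b hab using h
    refine ⟨fun i j ↦ (a i j : ℂ) + (b i j : ℂ) * eisensteinOmega, fun i j ↦ ⟨a i j, b i j, rfl⟩,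
      ?_⟩
    ext i j
    have hij := hab i j
    simp only [Matrix.add_apply, Matrix.smul_apply, smul_eq_mul, eisensteinOmega]
    linear_combination hij
  · rintro ⟨X, hX, rfl⟩ i j
    obtain ⟨a, b, hab⟩ := hX i j
    refine ⟨a, b, ?_⟩
    simp only [Matrix.add_apply, Matrix.smul_apply, smul_eq_mul, hab, eisensteinOmega]
    ring

/-- `Γ(N) ⊆ Aut(Λ)`: a matrix `≡ 1 (mod N)` in `𝓔` has entries in `𝓔`. [cite: AllcockFreitag2002, §2] -/
theorem eisensteinUnitaryLevel_subset_eisensteinUnitary (N : ℕ) :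
    eisensteinUnitaryLevel N ⊆ eisensteinUnitary := by
  intro γ hγ
  rw [mem_eisensteinUnitaryLevel_iff_exists] at hγ
  obtain ⟨⟨X, hX, rfl⟩, hU⟩ := hγ
  refine (mem_eisensteinUnitary_iff' _).mpr ⟨fun i j ↦ ?_, hU⟩
  simp only [Matrix.add_apply, Matrix.smul_apply, smul_eq_mul, Matrix.one_apply]
  refine IsEisensteinInteger.add ?_ ((IsEisensteinInteger.natCast N).mul (hX i j))
  split_ifs
  · exact IsEisensteinInteger.one
  · exact IsEisensteinInteger.zero

/-- **Level one is everything**: `Γ(1) = Aut(Λ)`. [cite: AllcockFreitag2002, §2] -/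
theorem eisensteinUnitaryLevel_one : eisensteinUnitaryLevel 1 = eisensteinUnitary := by
  refine Set.Subset.antisymm (eisensteinUnitaryLevel_subset_eisensteinUnitary 1) fun γ hγ ↦ ?_
  rw [mem_eisensteinUnitary_iff'] at hγ
  rw [mem_eisensteinUnitaryLevel_iff_exists]
  refine ⟨⟨γ - 1, fun i j ↦ ?_, by simp⟩, hγ.2⟩
  simp only [Matrix.sub_apply, Matrix.one_apply]
  refine (hγ.1 i j).sub ?_
  split_ifs
  · exact IsEisensteinInteger.one
  · exact IsEisensteinInteger.zero

/-- **Level zero is trivial**: `Γ(0) = {1}`. [folklore] -/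
theorem eisensteinUnitaryLevel_zero : eisensteinUnitaryLevel 0 = {1} := by
  ext γ
  rw [mem_eisensteinUnitaryLevel_iff_exists, Set.mem_singleton_iff]
  constructor
  · rintro ⟨⟨X, -, rfl⟩, -⟩
    simp
  · rintro rfl
    refine ⟨⟨0, fun _ _ ↦ IsEisensteinInteger.zero, by simp⟩, ?_⟩
    rw [Matrix.conjTranspose_one, Matrix.one_mul, Matrix.mul_one]

/-- **The levels are nested along divisibility**: `M ∣ N → Γ(N) ⊆ Γ(M)`.
[cite: AllcockFreitag2002, §2] -/
theorem eisensteinUnitaryLevel_subset_of_dvd {M N : ℕ} (h : M ∣ N) :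
    eisensteinUnitaryLevel N ⊆ eisensteinUnitaryLevel M := by
  obtain ⟨k, rfl⟩ := h
  intro γ hγ
  rw [mem_eisensteinUnitaryLevel_iff_exists] at hγ ⊢
  obtain ⟨⟨X, hX, rfl⟩, hU⟩ := hγ
  refine ⟨⟨(k : ℂ) • X, fun i j ↦ ?_, ?_⟩, hU⟩
  · simpa only [Matrix.smul_apply, smul_eq_mul] using (IsEisensteinInteger.natCast k).mul (hX i j)
  · rw [smul_smul, Nat.cast_mul]

/-! ### Group structure -/

/-- `1 ∈ Γ(N)`. [cite: AllcockFreitag2002, §2] -/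
theorem one_mem_eisensteinUnitaryLevel (N : ℕ) : (1 : Matrix (Fin 5) (Fin 5) ℂ) ∈
    eisensteinUnitaryLevel N := by
  rw [mem_eisensteinUnitaryLevel_iff_exists]
  refine ⟨⟨0, fun _ _ ↦ IsEisensteinInteger.zero, by simp⟩, ?_⟩
  rw [Matrix.conjTranspose_one, Matrix.one_mul, Matrix.mul_one]

/-- `1 ∈ Aut(Λ)`. [cite: AllcockFreitag2002, §2] -/
theorem one_mem_eisensteinUnitary : (1 : Matrix (Fin 5) (Fin 5) ℂ) ∈ eisensteinUnitary :=
  eisensteinUnitaryLevel_one ▸ one_mem_eisensteinUnitaryLevel 1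

/-- **`Γ(N)` is closed under products**: `(1 + NX)(1 + NY) = 1 + N(X + Y + NXY)` and
`(γδ)ᴴ J (γδ) = δᴴ (γᴴ J γ) δ`. [cite: AllcockFreitag2002, §2] -/
theorem mul_mem_eisensteinUnitaryLevel {N : ℕ} {γ δ : Matrix (Fin 5) (Fin 5) ℂ}
    (hγ : γ ∈ eisensteinUnitaryLevel N) (hδ : δ ∈ eisensteinUnitaryLevel N) :
    γ * δ ∈ eisensteinUnitaryLevel N := by
  rw [mem_eisensteinUnitaryLevel_iff_exists] at hγ hδ ⊢
  obtain ⟨⟨X, hX, rfl⟩, hγU⟩ := hγ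
  obtain ⟨⟨Y, hY, rfl⟩, hδU⟩ := hδ
  refine ⟨⟨X + Y + (N : ℂ) • (X * Y), fun i j ↦ ?_, ?_⟩, ?_⟩
  · simp only [Matrix.add_apply, Matrix.smul_apply, smul_eq_mul, Matrix.mul_apply]
    exact ((hX i j).add (hY i j)).add ((IsEisensteinInteger.natCast N).mul
      (IsEisensteinInteger.sum _ fun k _ ↦ (hX i k).mul (hY k j)))
  · simp only [add_mul, mul_add, Matrix.one_mul, Matrix.mul_one, smul_add, Matrix.smul_mul,
      Matrix.mul_smul, smul_smul]
    abel
  · calc (((1 : Matrix (Fin 5) (Fin 5) ℂ) + (N : ℂ) • X) * (1 + (N : ℂ) • Y))ᴴ * eisensteinGram *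
          ((1 + (N : ℂ) • X) * (1 + (N : ℂ) • Y))
        = (1 + (N : ℂ) • Y)ᴴ * ((1 + (N : ℂ) • X)ᴴ * eisensteinGram * (1 + (N : ℂ) • X)) *
            (1 + (N : ℂ) • Y) := by
          rw [Matrix.conjTranspose_mul]
          simp only [Matrix.mul_assoc]
      _ = eisensteinGram := by rw [hγU, hδU]

/-- **Elements of `Aut(Λ)` are invertible, with inverse `J γᴴ J`**: `(J γᴴ J) γ = J (γᴴ J γ)… = J J = 1`.
[cite: AllcockFreitag2002, §2] -/
theorem gram_mul_conjTranspose_mul_gram_mul_self {γ : Matrix (Fin 5) (Fin 5) ℂ}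
    (hγ : γ ∈ eisensteinUnitary) : eisensteinGram * γᴴ * eisensteinGram * γ = 1 := by
  have hU : γᴴ * eisensteinGram * γ = eisensteinGram := ((mem_eisensteinUnitary_iff' γ).mp hγ).2
  calc eisensteinGram * γᴴ * eisensteinGram * γ
      = eisensteinGram * (γᴴ * eisensteinGram * γ) := by simp only [Matrix.mul_assoc]
    _ = 1 := by rw [hU, eisensteinGram_mul_self]

/-- The matrix inverse of `γ ∈ Aut(Λ)` is `J γᴴ J`. [cite: AllcockFreitag2002, §2] -/
theorem inv_eq_of_mem_eisensteinUnitary {γ : Matrix (Fin 5) (Fin 5) ℂ}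
    (hγ : γ ∈ eisensteinUnitary) : γ⁻¹ = eisensteinGram * γᴴ * eisensteinGram :=
  Matrix.inv_eq_left_inv (gram_mul_conjTranspose_mul_gram_mul_self hγ)

/-- `γ γ⁻¹ = 1` and `γ⁻¹ γ = 1` for `γ ∈ Aut(Λ)` (genuine two-sided inverse, not Mathlib's junk
inverse of a singular matrix). [cite: AllcockFreitag2002, §2] -/
theorem mul_inv_of_mem_eisensteinUnitary {γ : Matrix (Fin 5) (Fin 5) ℂ}
    (hγ : γ ∈ eisensteinUnitary) : γ * γ⁻¹ = 1 ∧ γ⁻¹ * γ = 1 := by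
  have h : γ⁻¹ * γ = 1 := by
    rw [inv_eq_of_mem_eisensteinUnitary hγ]
    exact gram_mul_conjTranspose_mul_gram_mul_self hγ
  exact ⟨mul_eq_one_comm.mp h, h⟩

/-- For `γ ∈ Aut(Λ)` also `γ J γᴴ = J` (unitarity of the inverse). [cite: AllcockFreitag2002, §2] -/
theorem self_mul_gram_mul_conjTranspose {γ : Matrix (Fin 5) (Fin 5) ℂ}
    (hγ : γ ∈ eisensteinUnitary) : γ * eisensteinGram * γᴴ = eisensteinGram := by
  have h1 : γ * (eisensteinGram * γᴴ * eisensteinGram) = 1 := by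
    rw [← inv_eq_of_mem_eisensteinUnitary hγ]
    exact (mul_inv_of_mem_eisensteinUnitary hγ).1
  calc γ * eisensteinGram * γᴴ
      = γ * (eisensteinGram * γᴴ * eisensteinGram) * eisensteinGram := by
        simp only [Matrix.mul_assoc, eisensteinGram_mul_self, Matrix.mul_one]
    _ = eisensteinGram := by rw [h1, Matrix.one_mul]

/-- **`Γ(N)` is closed under inverses**: `γ⁻¹ = J γᴴ J`, and `J γᴴ J − 1 = J (γ − 1)ᴴ J = N · J Xᴴ J`
has entries `± N · conj(Xⱼᵢ) ∈ N𝓔` (`𝓔` is conjugation-stable); unitarity from `γ J γᴴ = J`.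
[cite: AllcockFreitag2002, §2] -/
theorem inv_mem_eisensteinUnitaryLevel {N : ℕ} {γ : Matrix (Fin 5) (Fin 5) ℂ}
    (hγ : γ ∈ eisensteinUnitaryLevel N) : γ⁻¹ ∈ eisensteinUnitaryLevel N := by
  have hγA : γ ∈ eisensteinUnitary := eisensteinUnitaryLevel_subset_eisensteinUnitary N hγ
  rw [inv_eq_of_mem_eisensteinUnitary hγA]
  rw [mem_eisensteinUnitaryLevel_iff_exists] at hγ ⊢
  obtain ⟨⟨X, hX, hγX⟩, -⟩ := hγ
  refine ⟨⟨eisensteinGram * Xᴴ * eisensteinGram, fun i j ↦ ?_, ?_⟩, ?_⟩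
  · simp only [eisensteinGram, Matrix.mul_diagonal, Matrix.diagonal_mul,
      Matrix.conjTranspose_apply]
    exact ((isEisensteinInteger_eisensteinGram_diag i).mul (hX j i).star).mul
      (isEisensteinInteger_eisensteinGram_diag j)
  · have hN : star (N : ℂ) = (N : ℂ) := Complex.conj_natCast N
    rw [hγX, Matrix.conjTranspose_add, Matrix.conjTranspose_one, Matrix.conjTranspose_smul, hN,
      mul_add, add_mul, Matrix.mul_one, eisensteinGram_mul_self, Matrix.mul_smul,
      Matrix.smul_mul]
  · calc (eisensteinGram * γᴴ * eisensteinGram)ᴴ * eisensteinGram *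
          (eisensteinGram * γᴴ * eisensteinGram)
        = eisensteinGram * (γ * eisensteinGram * γᴴ) * eisensteinGram := by
          rw [Matrix.conjTranspose_mul, Matrix.conjTranspose_mul, conjTranspose_eisensteinGram,
            Matrix.conjTranspose_conjTranspose]
          simp only [Matrix.mul_assoc, eisensteinGram_mul_self, Matrix.mul_one]
      _ = eisensteinGram := by
          rw [self_mul_gram_mul_conjTranspose hγA, eisensteinGram_mul_self, Matrix.one_mul]

/-- `Aut(Λ)` is closed under products and inverses (the case `N = 1`). [cite: AllcockFreitag2002, §2] -/
theorem mul_mem_eisensteinUnitary {γ δ : Matrix (Fin 5) (Fin 5) ℂ} (hγ : γ ∈ eisensteinUnitary)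
    (hδ : δ ∈ eisensteinUnitary) : γ * δ ∈ eisensteinUnitary := by
  rw [← eisensteinUnitaryLevel_one] at hγ hδ ⊢
  exact mul_mem_eisensteinUnitaryLevel hγ hδ

/-- `Aut(Λ)` is closed under inverses. [cite: AllcockFreitag2002, §2] -/
theorem inv_mem_eisensteinUnitary {γ : Matrix (Fin 5) (Fin 5) ℂ} (hγ : γ ∈ eisensteinUnitary) :
    γ⁻¹ ∈ eisensteinUnitary := by
  rw [← eisensteinUnitaryLevel_one] at hγ ⊢
  exact inv_mem_eisensteinUnitaryLevel hγ

/-- **`Γ(N)` is normal in `Aut(Λ)`**: `g (1 + N X) g⁻¹ = 1 + N · g X g⁻¹` with `g X g⁻¹` integral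
(`g⁻¹ = J gᴴ J` is integral). [cite: AllcockFreitag2002, §2] -/
theorem conj_mem_eisensteinUnitaryLevel {N : ℕ} {g γ : Matrix (Fin 5) (Fin 5) ℂ}
    (hg : g ∈ eisensteinUnitary) (hγ : γ ∈ eisensteinUnitaryLevel N) :
    g * γ * g⁻¹ ∈ eisensteinUnitaryLevel N := by
  have hg' : g⁻¹ ∈ eisensteinUnitary := inv_mem_eisensteinUnitary hg
  have hU : g * γ * g⁻¹ ∈ eisensteinUnitary :=
    mul_mem_eisensteinUnitary (mul_mem_eisensteinUnitary hg
      (eisensteinUnitaryLevel_subset_eisensteinUnitary N hγ)) hg'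
  rw [mem_eisensteinUnitaryLevel_iff_exists] at hγ ⊢
  obtain ⟨⟨X, hX, rfl⟩, -⟩ := hγ
  refine ⟨⟨g * X * g⁻¹, fun i j ↦ ?_, ?_⟩, ((mem_eisensteinUnitary_iff' _).mp hU).2⟩
  · simp only [Matrix.mul_apply]
    exact IsEisensteinInteger.sum _ fun k _ ↦
      (IsEisensteinInteger.sum _ fun l _ ↦ (((mem_eisensteinUnitary_iff' g).mp hg).1 i l).mul
        (hX l k)).mul (((mem_eisensteinUnitary_iff' _).mp hg').1 k j)
  · rw [mul_add, add_mul, Matrix.mul_one, (mul_inv_of_mem_eisensteinUnitary hg).1,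
      Matrix.mul_smul, Matrix.smul_mul]

end Literature.AlgebraicGeometry.ShimuraVarieties

end
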